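import Mathlib
import Summits.ValiantsHypothesis.ValiantsHypothesis.Theorems.LacunarySymmetroidMatrixDescartesInertiaWindow

/-!
# `MatrixDescartes` (stmt-ValiantsHypothesis-18050) — INERTIA KIT, III-a: FIRST-ORDER PERSISTENCE — a negative family of
# `F(x₀)` and a kernel family on which the first-order term is negative stay JOINTLY negative just right of `x₀`

HONEST FRAMING.  Cell `pub-symmetroid`, seat `val-sym-mdr-p2` (gen 17); helper file `--supports` the crux
`Theses.LacunarySymmetroid.MatrixDescartes`, NO closure claim.  General linear algebra / topology for entrywise-continuous real
matrix families with a first-order expansion `F x = F x₀ + (x − x₀) • G x` at a point (every lacunary symmetric pencil at every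
format is such a family); it is the engine of the SIGNATURE LAW FOR INERTIA JUMPS (`…InertiaJump`, `…InertiaJumpPencil`).
Nothing here bears on the crux in its window, on `stub_twoSided`, on `DoorA26`/`DoorA34`, registers, or `VP ≠ VNP`.

CONTENT (family language of `…InertiaKit`).  `eventually_neg_of_homogeneous`: the abstract persistence lemma behind g16's
`Inertia.eventually_neg_family` — a jointly continuous `Q(s, c)`, 2-homogeneous in `c` and negative on `c ≠ 0` at `s₀`, stays
negative on `c ≠ 0` for `s` near `s₀` (compact coefficient sphere + tube lemma).  `eventually_neg_family_sq` (square-parameter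
form) and `eventually_neg_joint_family_right/left`: if `F x₀` (symmetric) is negative on the combinations of a family `v`,
every `n j` is a KERNEL vector of `F x₀`, and `G x₀` is negative (resp. positive) on the combinations of `n`, then for `x > x₀`
(resp. `x < x₀`) near `x₀` the matrix `F x` is negative on the combinations of the JOINT family `Sum.elim v n`.  MECHANISM: with
`x = x₀ + s²` the form on `A + N` is `AᵀF(x₀)A + s²(A+N)ᵀG(x)(A+N)` (`form_split`; the cross terms die on the kernel); the
substitution `N = N′/s` turns it into `AᵀF(x₀)A + (sA + N′)ᵀG(x₀+s²)(sA + N′)`, continuous in `(s, A, N′)` and negative at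
`s = 0`, so persistence applies and the rescaling is undone for `s ≠ 0`.  No eigenvalue branches, no norms beyond the unit
sphere of coefficients. [folklore]; axioms standard; no definitions.
-/

-- layout Summits/ValiantsHypothesis/ValiantsHypothesis forces the duplicated namespace component
set_option linter.dupNamespace false

namespace Summit.ValiantsHypothesis.ValiantsHypothesis.Theorems.LacunarySymmetroidMatrixDescartes

open Matrix Finset
open scoped BigOperators Topology

namespace Inertia

variable {ι : Type} [Fintype ι]

/-! ## §1 First-order persistence -/

/-- **Persistence for homogeneous forms.**  `Q : ℝ → (γ → ℝ) → ℝ` jointly continuous, `Q s (t • c) = t*t * Q s c`, and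
`Q s₀ c < 0` for every `c ≠ 0`.  Then `Q s c < 0` for every `c ≠ 0` and all `s` near `s₀` (compact unit sphere + tube
lemma). [folklore] -/
theorem eventually_neg_of_homogeneous {γ : Type} [Fintype γ] (Q : ℝ → (γ → ℝ) → ℝ)
    (hQ : Continuous fun p : ℝ × (γ → ℝ) => Q p.1 p.2) (hhom : ∀ s t c, Q s (t • c) = t * t * Q s c)
    (s₀ : ℝ) (h0 : ∀ c : γ → ℝ, c ≠ 0 → Q s₀ c < 0) :
    ∀ᶠ s in 𝓝 s₀, ∀ c : γ → ℝ, c ≠ 0 → Q s c < 0 := by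
  have hK : IsCompact (Metric.sphere (0 : γ → ℝ) 1) := isCompact_sphere _ _
  have hP : ∀ c ∈ Metric.sphere (0 : γ → ℝ) 1, ∀ᶠ z : ℝ × (γ → ℝ) in 𝓝 (s₀, c), Q z.1 z.2 < 0 := by
    intro c hc
    have hc0 : c ≠ 0 := by
      intro h; rw [h] at hc; simp at hc
    exact hQ.continuousAt.eventually_lt continuousAt_const (h0 c hc0)
  have h := hK.eventually_forall_of_forall_eventually (P := fun x y => Q x y < 0) hP
  refine h.mono fun s hs c hc0 => ?_
  have hnorm : 0 < ‖c‖ := norm_pos_iff.2 hc0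
  have hc₁mem : ‖c‖⁻¹ • c ∈ Metric.sphere (0 : γ → ℝ) 1 := by
    rw [mem_sphere_zero_iff_norm, norm_smul, norm_inv, norm_norm, inv_mul_cancel₀ hnorm.ne']
  have hs₁ := hs _ hc₁mem
  have hcc : c = ‖c‖ • (‖c‖⁻¹ • c) := by rw [smul_smul, mul_inv_cancel₀ hnorm.ne', one_smul]
  rw [hcc, hhom]
  exact mul_neg_of_pos_of_neg (mul_pos hnorm hnorm) hs₁

omit [Fintype ι] in
/-- Continuity of a combination's coordinate in the coefficients. [folklore] -/
theorem continuous_comb_apply {α : Type} [Fintype α] (v : α → ι → ℝ) (a : ι) :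
    Continuous fun c : α → ℝ => (∑ i, c i • v i) a := by
  have h : (fun c : α → ℝ => (∑ i, c i • v i) a) = fun c => ∑ i, c i * v i a := by
    funext c; simp [Finset.sum_apply, Pi.smul_apply, smul_eq_mul]
  rw [h]
  exact continuous_finsetSum _ fun i _ => (continuous_apply i).mul continuous_const

/-- Joint continuity of `(s, u, w) ↦ uᵀ M(s) w` along continuous vector-valued maps. [folklore] -/
theorem continuous_dot_mulVec {X : Type} [TopologicalSpace X] (M : X → Matrix ι ι ℝ)
    (hM : ∀ i j, Continuous fun x => M x i j) (u w : X → ι → ℝ)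
    (hu : ∀ a, Continuous fun x => u x a) (hw : ∀ a, Continuous fun x => w x a) :
    Continuous fun x => u x ⬝ᵥ (M x *ᵥ w x) := by
  unfold dotProduct Matrix.mulVec
  refine continuous_finsetSum _ fun a _ => (hu a).mul ?_
  exact continuous_finsetSum _ fun b _ => (hM a b).mul (hw b)

omit [Fintype ι] in
/-- Splitting a combination over `α ⊕ β`. [folklore] -/
theorem sum_elim_comb {α β : Type} [Fintype α] [Fintype β] (v : α → ι → ℝ) (n : β → ι → ℝ) (e : α ⊕ β → ℝ) :
    ∑ k, e k • Sum.elim v n k = (∑ i, e (Sum.inl i) • v i) + ∑ j, e (Sum.inr j) • n j := by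
  rw [Fintype.sum_sum_type]
  rfl

/-- The form of `F₀ + s² • G` on `A + N` with `F₀ N = 0`, `F₀` symmetric:
`(A+N)ᵀ(F₀ + s²G)(A+N) = AᵀF₀A + (sA + sN)ᵀ G (sA + sN)`. [folklore] -/
theorem form_split (F₀ G : Matrix ι ι ℝ) (hF₀ : F₀.IsSymm) (s : ℝ) (A N : ι → ℝ) (hN : F₀ *ᵥ N = 0) :
    (A + N) ⬝ᵥ ((F₀ + (s ^ 2) • G) *ᵥ (A + N))
      = A ⬝ᵥ (F₀ *ᵥ A) + (s • A + s • N) ⬝ᵥ (G *ᵥ (s • A + s • N)) := by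
  have hNA : N ⬝ᵥ (F₀ *ᵥ A) = 0 := by
    rw [Matrix.dotProduct_mulVec, ← Matrix.mulVec_transpose, hF₀.eq, hN, zero_dotProduct]
  have h1 : (A + N) ⬝ᵥ (F₀ *ᵥ (A + N)) = A ⬝ᵥ (F₀ *ᵥ A) := by
    rw [Matrix.mulVec_add, hN, add_zero, add_dotProduct, hNA, add_zero]
  have h2 : (s • A + s • N) ⬝ᵥ (G *ᵥ (s • A + s • N)) = s ^ 2 * ((A + N) ⬝ᵥ (G *ᵥ (A + N))) := by
    rw [← smul_add, Matrix.mulVec_smul, smul_dotProduct, dotProduct_smul, smul_eq_mul, smul_eq_mul, sq, mul_assoc]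
  rw [Matrix.add_mulVec, dotProduct_add, h1, Matrix.smul_mulVec, dotProduct_smul, smul_eq_mul, h2]

/-- **FIRST-ORDER PERSISTENCE (square-parameter form).**  `P s = F₀ + s² • G s` with `G` entrywise continuous and `F₀`
symmetric; `F₀` negative on the combinations of `v`, every `n j` a kernel vector of `F₀`, and `G 0` negative on the
combinations of `n`.  Then for `s ≠ 0` near `0`, `P s` is negative on the combinations of the joint family `Sum.elim v n`.
[folklore] -/
theorem eventually_neg_family_sq {α β : Type} [Fintype α] [Fintype β] (P G : ℝ → Matrix ι ι ℝ) (F₀ : Matrix ι ι ℝ)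
    (hG : ∀ i j, Continuous fun s => G s i j) (hP : ∀ s, P s = F₀ + (s ^ 2) • G s) (hF₀ : F₀.IsSymm)
    (v : α → ι → ℝ) (n : β → ι → ℝ)
    (hv : ∀ a : α → ℝ, a ≠ 0 → (∑ i, a i • v i) ⬝ᵥ (F₀ *ᵥ ∑ i, a i • v i) < 0)
    (hn0 : ∀ j, F₀ *ᵥ n j = 0)
    (hn : ∀ c : β → ℝ, c ≠ 0 → (∑ j, c j • n j) ⬝ᵥ (G 0 *ᵥ ∑ j, c j • n j) < 0) :
    ∀ᶠ s in 𝓝 (0 : ℝ), s ≠ 0 → ∀ e : α ⊕ β → ℝ, e ≠ 0 →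
      (∑ k, e k • Sum.elim v n k) ⬝ᵥ (P s *ᵥ ∑ k, e k • Sum.elim v n k) < 0 := by
  -- the rescaled form `Q(s; e) = AᵀF₀A + (sA + N)ᵀ G(s) (sA + N)`
  set Q : ℝ → (α ⊕ β → ℝ) → ℝ := fun s e =>
    (∑ i, e (Sum.inl i) • v i) ⬝ᵥ (F₀ *ᵥ ∑ i, e (Sum.inl i) • v i)
      + (s • (∑ i, e (Sum.inl i) • v i) + ∑ j, e (Sum.inr j) • n j)
          ⬝ᵥ (G s *ᵥ (s • (∑ i, e (Sum.inl i) • v i) + ∑ j, e (Sum.inr j) • n j)) with hQdef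
  -- joint continuity
  have hA : ∀ a, Continuous fun p : ℝ × (α ⊕ β → ℝ) => (∑ i, p.2 (Sum.inl i) • v i) a := fun a =>
    (continuous_comb_apply v a).comp ((continuous_pi fun i => (continuous_apply (Sum.inl i))).comp continuous_snd)
  have hN : ∀ a, Continuous fun p : ℝ × (α ⊕ β → ℝ) => (∑ j, p.2 (Sum.inr j) • n j) a := fun a =>
    (continuous_comb_apply n a).comp ((continuous_pi fun j => (continuous_apply (Sum.inr j))).comp continuous_snd)
  have hSN : ∀ a, Continuous fun p : ℝ × (α ⊕ β → ℝ) =>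
      (p.1 • (∑ i, p.2 (Sum.inl i) • v i) + ∑ j, p.2 (Sum.inr j) • n j) a := by
    intro a
    have h : (fun p : ℝ × (α ⊕ β → ℝ) => (p.1 • (∑ i, p.2 (Sum.inl i) • v i) + ∑ j, p.2 (Sum.inr j) • n j) a)
        = fun p => p.1 * (∑ i, p.2 (Sum.inl i) • v i) a + (∑ j, p.2 (Sum.inr j) • n j) a := by
      funext p; simp [Pi.add_apply, Pi.smul_apply, smul_eq_mul]
    rw [h]
    exact (continuous_fst.mul (hA a)).add (hN a)
  have hQc : Continuous fun p : ℝ × (α ⊕ β → ℝ) => Q p.1 p.2 := by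
    simp only [hQdef]
    refine Continuous.add ?_ ?_
    · exact continuous_dot_mulVec (fun _ : ℝ × (α ⊕ β → ℝ) => F₀) (fun _ _ => continuous_const) _ _ hA hA
    · exact continuous_dot_mulVec (fun p : ℝ × (α ⊕ β → ℝ) => G p.1) (fun i j => (hG i j).comp continuous_fst) _ _
        hSN hSN
  -- homogeneity of degree two
  have hcombA : ∀ (t : ℝ) (e : α ⊕ β → ℝ), (∑ i, (t • e) (Sum.inl i) • v i) = t • ∑ i, e (Sum.inl i) • v i := by
    intro t e
    rw [Finset.smul_sum]
    exact Finset.sum_congr rfl fun i _ => by rw [Pi.smul_apply, smul_eq_mul, mul_smul]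
  have hcombN : ∀ (t : ℝ) (e : α ⊕ β → ℝ), (∑ j, (t • e) (Sum.inr j) • n j) = t • ∑ j, e (Sum.inr j) • n j := by
    intro t e
    rw [Finset.smul_sum]
    exact Finset.sum_congr rfl fun j _ => by rw [Pi.smul_apply, smul_eq_mul, mul_smul]
  have hhom : ∀ s t e, Q s (t • e) = t * t * Q s e := by
    intro s t e
    simp only [hQdef]
    rw [hcombA, hcombN, smul_comm s t, ← smul_add, Matrix.mulVec_smul, Matrix.mulVec_smul, smul_dotProduct,
      dotProduct_smul, smul_dotProduct, dotProduct_smul, smul_eq_mul, smul_eq_mul, smul_eq_mul, smul_eq_mul]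
    ring
  -- negativity at `s = 0`
  have h0 : ∀ e : α ⊕ β → ℝ, e ≠ 0 → Q 0 e < 0 := by
    intro e he
    simp only [hQdef, zero_smul, zero_add]
    by_cases ha : (fun i => e (Sum.inl i)) = 0
    · -- the `v`-part vanishes, so the `n`-part does not
      have hc : (fun j => e (Sum.inr j)) ≠ 0 := by
        intro hc
        apply he
        funext k
        rcases k with i | j
        · exact congrFun ha i
        · exact congrFun hc j
      have hA0 : (∑ i, e (Sum.inl i) • v i) = 0 :=
        Finset.sum_eq_zero fun i _ => by rw [show e (Sum.inl i) = 0 from congrFun ha i, zero_smul]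
      rw [hA0, zero_dotProduct, zero_add]
      exact hn _ hc
    · have h1 := hv _ ha
      have h2 : (∑ j, e (Sum.inr j) • n j) ⬝ᵥ (G 0 *ᵥ ∑ j, e (Sum.inr j) • n j) ≤ 0 := by
        by_cases hc : (fun j => e (Sum.inr j)) = 0
        · have hN0 : (∑ j, e (Sum.inr j) • n j) = 0 :=
            Finset.sum_eq_zero fun j _ => by rw [show e (Sum.inr j) = 0 from congrFun hc j, zero_smul]
          rw [hN0, zero_dotProduct]
        · exact (hn _ hc).le
      linarith
  -- persistence, then undo the rescaling
  have hev := eventually_neg_of_homogeneous Q hQc hhom 0 h0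
  refine hev.mono fun s hs hs0 e he => ?_
  -- rescaled coefficients `e' = (a, s • c)`
  set e' : α ⊕ β → ℝ := Sum.elim (fun i => e (Sum.inl i)) (fun j => s * e (Sum.inr j)) with he'
  have he'0 : e' ≠ 0 := by
    intro h
    apply he
    funext k
    rcases k with i | j
    · exact congrFun h (Sum.inl i)
    · have := congrFun h (Sum.inr j)
      simp only [he', Sum.elim_inr, Pi.zero_apply, mul_eq_zero] at this
      exact this.resolve_left hs0
  have hQ' := hs e' he'0
  have hA' : (∑ i, e' (Sum.inl i) • v i) = ∑ i, e (Sum.inl i) • v i := by simp [he']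
  have hN' : (∑ j, e' (Sum.inr j) • n j) = s • ∑ j, e (Sum.inr j) • n j := by
    simp only [he', Sum.elim_inr]
    rw [Finset.smul_sum]
    exact Finset.sum_congr rfl fun j _ => by rw [mul_smul]
  simp only [hQdef] at hQ'
  rw [hA', hN'] at hQ'
  have hker : F₀ *ᵥ (∑ j, e (Sum.inr j) • n j) = 0 := by
    rw [Matrix.mulVec_sum]
    exact Finset.sum_eq_zero fun j _ => by rw [Matrix.mulVec_smul, hn0, smul_zero]
  rw [sum_elim_comb, hP s, form_split F₀ (G s) hF₀ s _ _ hker]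
  exact hQ'

/-- **FIRST-ORDER PERSISTENCE, right of `x₀`.**  `F x = F x₀ + (x − x₀) • G x` (`G` entrywise continuous, `F x₀`
symmetric), `F x₀` negative on the combinations of `v`, `n` a family of kernel vectors of `F x₀` on whose combinations `G x₀`
is NEGATIVE.  Then for `x > x₀` near `x₀`, `F x` is negative on the combinations of the joint family. [folklore] -/
theorem eventually_neg_joint_family_right {α β : Type} [Fintype α] [Fintype β] (F G : ℝ → Matrix ι ι ℝ) (x₀ : ℝ)
    (hG : ∀ i j, Continuous fun x => G x i j) (hFG : ∀ x, F x = F x₀ + (x - x₀) • G x) (hsym : (F x₀).IsSymm)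
    (v : α → ι → ℝ) (n : β → ι → ℝ)
    (hv : ∀ a : α → ℝ, a ≠ 0 → (∑ i, a i • v i) ⬝ᵥ (F x₀ *ᵥ ∑ i, a i • v i) < 0)
    (hn0 : ∀ j, F x₀ *ᵥ n j = 0)
    (hn : ∀ c : β → ℝ, c ≠ 0 → (∑ j, c j • n j) ⬝ᵥ (G x₀ *ᵥ ∑ j, c j • n j) < 0) :
    ∀ᶠ x in 𝓝[>] x₀, ∀ e : α ⊕ β → ℝ, e ≠ 0 →
      (∑ k, e k • Sum.elim v n k) ⬝ᵥ (F x *ᵥ ∑ k, e k • Sum.elim v n k) < 0 := by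
  have hsq := eventually_neg_family_sq (fun s => F (x₀ + s ^ 2)) (fun s => G (x₀ + s ^ 2)) (F x₀)
    (fun i j => (hG i j).comp (continuous_const.add (continuous_pow 2)))
    (fun s => by rw [hFG (x₀ + s ^ 2), add_sub_cancel_left]) hsym v n hv hn0
    (by simpa using hn)
  -- transport along `s = √(x − x₀) → 0`
  have ht : Filter.Tendsto (fun x : ℝ => Real.sqrt (x - x₀)) (𝓝 x₀) (𝓝 0) := by
    have hc : Continuous fun x : ℝ => Real.sqrt (x - x₀) := Real.continuous_sqrt.comp (continuous_id.sub continuous_const)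
    have := hc.tendsto x₀
    simpa using this
  have h1 : ∀ᶠ x in 𝓝[>] x₀, Real.sqrt (x - x₀) ≠ 0 → ∀ e : α ⊕ β → ℝ, e ≠ 0 →
      (∑ k, e k • Sum.elim v n k) ⬝ᵥ (F (x₀ + Real.sqrt (x - x₀) ^ 2) *ᵥ ∑ k, e k • Sum.elim v n k) < 0 :=
    nhdsWithin_le_nhds (ht.eventually hsq)
  have h2 : ∀ᶠ x in 𝓝[>] x₀, x₀ < x := eventually_nhdsWithin_of_forall fun x hx => hx
  refine (h1.and h2).mono fun x hx e he => ?_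
  obtain ⟨hx1, hx2⟩ := hx
  have hpos : 0 < x - x₀ := sub_pos.2 hx2
  have hs0 : Real.sqrt (x - x₀) ≠ 0 := (Real.sqrt_pos.2 hpos).ne'
  have hxx : x₀ + Real.sqrt (x - x₀) ^ 2 = x := by rw [Real.sq_sqrt hpos.le]; ring
  have := hx1 hs0 e he
  rwa [hxx] at this

/-- **FIRST-ORDER PERSISTENCE, left of `x₀`.**  Same, with `G x₀` POSITIVE on the combinations of the kernel family `n`:
for `x < x₀` near `x₀`, `F x` is negative on the combinations of the joint family. [folklore] -/
theorem eventually_neg_joint_family_left {α β : Type} [Fintype α] [Fintype β] (F G : ℝ → Matrix ι ι ℝ) (x₀ : ℝ)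
    (hG : ∀ i j, Continuous fun x => G x i j) (hFG : ∀ x, F x = F x₀ + (x - x₀) • G x) (hsym : (F x₀).IsSymm)
    (v : α → ι → ℝ) (n : β → ι → ℝ)
    (hv : ∀ a : α → ℝ, a ≠ 0 → (∑ i, a i • v i) ⬝ᵥ (F x₀ *ᵥ ∑ i, a i • v i) < 0)
    (hn0 : ∀ j, F x₀ *ᵥ n j = 0)
    (hn : ∀ c : β → ℝ, c ≠ 0 → 0 < (∑ j, c j • n j) ⬝ᵥ (G x₀ *ᵥ ∑ j, c j • n j)) :
    ∀ᶠ x in 𝓝[<] x₀, ∀ e : α ⊕ β → ℝ, e ≠ 0 →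
      (∑ k, e k • Sum.elim v n k) ⬝ᵥ (F x *ᵥ ∑ k, e k • Sum.elim v n k) < 0 := by
  have hsq := eventually_neg_family_sq (fun s => F (x₀ - s ^ 2)) (fun s => -G (x₀ - s ^ 2)) (F x₀)
    (fun i j => by
      have h := ((hG i j).comp (continuous_const.sub (continuous_pow 2) : Continuous fun s : ℝ => x₀ - s ^ 2)).neg
      refine h.congr fun s => ?_
      simp [Matrix.neg_apply])
    (fun s => by
      rw [hFG (x₀ - s ^ 2), show x₀ - s ^ 2 - x₀ = -(s ^ 2) by ring, smul_neg, neg_smul]) hsym v n hv hn0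
    (by
      intro c hc
      have := hn c hc
      simp only [sub_zero, ne_eq, OfNat.ofNat_ne_zero, not_false_eq_true, zero_pow]
      rw [Matrix.neg_mulVec, dotProduct_neg, neg_lt_zero]
      exact this)
  have ht : Filter.Tendsto (fun x : ℝ => Real.sqrt (x₀ - x)) (𝓝 x₀) (𝓝 0) := by
    have hc : Continuous fun x : ℝ => Real.sqrt (x₀ - x) := Real.continuous_sqrt.comp (continuous_const.sub continuous_id)
    have := hc.tendsto x₀
    simpa using this
  have h1 : ∀ᶠ x in 𝓝[<] x₀, Real.sqrt (x₀ - x) ≠ 0 → ∀ e : α ⊕ β → ℝ, e ≠ 0 →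
      (∑ k, e k • Sum.elim v n k) ⬝ᵥ (F (x₀ - Real.sqrt (x₀ - x) ^ 2) *ᵥ ∑ k, e k • Sum.elim v n k) < 0 :=
    nhdsWithin_le_nhds (ht.eventually hsq)
  have h2 : ∀ᶠ x in 𝓝[<] x₀, x < x₀ := eventually_nhdsWithin_of_forall fun x hx => hx
  refine (h1.and h2).mono fun x hx e he => ?_
  obtain ⟨hx1, hx2⟩ := hx
  have hpos : 0 < x₀ - x := sub_pos.2 hx2
  have hs0 : Real.sqrt (x₀ - x) ≠ 0 := (Real.sqrt_pos.2 hpos).ne'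
  have hxx : x₀ - Real.sqrt (x₀ - x) ^ 2 = x := by rw [Real.sq_sqrt hpos.le]; ring
  have := hx1 hs0 e he
  rwa [hxx] at this

end Inertia

end Summit.ValiantsHypothesis.ValiantsHypothesis.Theorems.LacunarySymmetroidMatrixDescartes
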